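import Literature.Analysis.FluidPDE.ClassicalLocalEnergyCutoff
import HarnessLib

/-!
# Route HardyPointSink — `HardyBalanceLaw`: the cut-off local energy identity on a closed time interval

Helper file for item stmt-NavierStokesRegularity-8388 (`HardyBalanceLaw`). The tree's
`IsClassicalNSSolutionOn.local_energy_identity_cutoff` (`ClassicalLocalEnergyCutoff.lean`) is
the local energy identity of a classical solution of the unforced Navier–Stokes system against a
smooth compactly supported spatial weight `φ`, integrated between two times of an **open** time
set. The Hardy balance law is stated for classical solutions on the **closed** interval
`[0, T]` and for all `0 ≤ t₀ ≤ t₁ ≤ T`, endpoints included; this file re-glues the identity on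
`Icc 0 T`: the integral `∫ φ|u(t)|²` is continuous on `[0, T]`, differentiable at interior times
(where the one-sided time derivative within `[0, T]` is the two-sided one), and its derivative
`∫ φ · 2⟪u, ∂ₜu⟫`, the flux `∫ (νΔφ|u|² + Dφ(u)|u|² + 2pDφ(u))` and the dissipation `∫ |∇u|²φ`
are continuous on `[0, T]` (joint continuity of `u`, `∂ₜu`, `∇u` up to the boundary, from
`uniqueDiffOn_Icc`), so the fundamental theorem of calculus applies on `[t₀, t₁] ⊆ [0, T]`.
-/

noncomputable section

open MeasureTheory TopologicalSpace Set Function Filter Metric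
open _root_.Topology
open scoped Laplacian InnerProductSpace RealInnerProductSpace ENNReal NNReal ContDiff
open Literature.Analysis.FluidPDE

set_option linter.dupNamespace false -- nested layout Summit.<S>.<Sub>, Sub = S (D-0017)

namespace Summit.NavierStokesRegularity.NavierStokesRegularity.Theorems

variable {E : Type*} [NormedAddCommGroup E] [InnerProductSpace ℝ E] [FiniteDimensional ℝ E]
  [MeasurableSpace E] [BorelSpace E]

variable {T ν : ℝ} {u : ℝ → E → E} {p : ℝ → E → ℝ}

/-- `s ↦ ∫ φ |u(s)|²` is continuous on `[0, T]` for a classical solution on `[0, T]` and a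
continuous compactly supported weight. -/
theorem hardyPointSink_continuousOn_integral_cutoff_norm_sq
    (h : IsClassicalNSSolutionOn (Icc 0 T) ν 0 u p) {φ : E → ℝ} (hφ : Continuous φ)
    (hφc : HasCompactSupport φ) :
    ContinuousOn (fun s => ∫ x, φ x * ‖u s x‖ ^ 2) (Icc 0 T) := by
  refine continuousOn_integral_of_support_subset (μ := volume) (K := tsupport φ) hφc ?_ ?_
  · have cu := h.smooth_velocity.continuousOn
    have c1 : ContinuousOn (fun z : ℝ × E => φ z.2) (Icc 0 T ×ˢ univ) :=
      (hφ.comp continuous_snd).continuousOn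
    exact c1.mul (cu.norm.pow 2)
  · intro s _ x hx
    show φ x * ‖u s x‖ ^ 2 = 0
    rw [image_eq_zero_of_notMem_tsupport hx, zero_mul]

/-- `s ↦ ∫ φ · 2⟪u(s), ∂ₜu(s)⟫` (one-sided time derivative within `[0, T]`) is continuous on
`[0, T]`, `T > 0`. -/
theorem hardyPointSink_continuousOn_integral_cutoff_inner_timeDeriv (hT : 0 < T)
    (h : IsClassicalNSSolutionOn (Icc 0 T) ν 0 u p) {φ : E → ℝ} (hφ : Continuous φ)
    (hφc : HasCompactSupport φ) :
    ContinuousOn (fun s => ∫ x, φ x * (2 * ⟪u s x, timeDerivWithin (Icc 0 T) u s x⟫))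
      (Icc 0 T) := by
  refine continuousOn_integral_of_support_subset (μ := volume) (K := tsupport φ) hφc ?_ ?_
  · have h1 := h.smooth_velocity.continuousOn_timeDerivWithin (uniqueDiffOn_Icc hT)
    have h2 := h.smooth_velocity.continuousOn
    have h3 : ContinuousOn (fun z : ℝ × E => φ z.2) (Icc 0 T ×ˢ univ) :=
      (hφ.comp continuous_snd).continuousOn
    exact h3.mul (continuousOn_const.mul (h2.inner h1))
  · intro s _ x hx
    show φ x * (2 * ⟪u s x, timeDerivWithin (Icc 0 T) u s x⟫) = 0
    rw [image_eq_zero_of_notMem_tsupport hx, zero_mul]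

/-- The localised dissipation `s ↦ ∫ |∇u(s)|² φ` is continuous on `[0, T]`, `T > 0`. -/
theorem hardyPointSink_continuousOn_integral_dissipation_cutoff (hT : 0 < T)
    (h : IsClassicalNSSolutionOn (Icc 0 T) ν 0 u p) {φ : E → ℝ} (hφ : Continuous φ)
    (hφc : HasCompactSupport φ) :
    ContinuousOn (fun s => ∫ x, frobeniusNormSq (fderiv ℝ (u s) x) * φ x) (Icc 0 T) := by
  refine continuousOn_integral_of_support_subset (μ := volume) (K := tsupport φ) hφc ?_ ?_
  · have hu1 : ContDiffOn ℝ 1 (uncurry u) (Icc 0 T ×ˢ univ) :=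
      h.smooth_velocity.of_le (by norm_cast)
    have cDu : ContinuousOn (fun z : ℝ × E => fderiv ℝ (u z.1) z.2) (Icc 0 T ×ˢ univ) :=
      continuousOn_fderiv_slice_of_contDiffOn hu1 (uniqueDiffOn_Icc hT)
    have c1 : ContinuousOn (fun z : ℝ × E => frobeniusNormSq (fderiv ℝ (u z.1) z.2))
        (Icc 0 T ×ˢ univ) :=
      LerayHopfProofs.continuous_frobeniusNormSq.comp_continuousOn cDu
    exact c1.mul (hφ.comp continuous_snd).continuousOn
  · intro s _ x hx
    show frobeniusNormSq (fderiv ℝ (u s) x) * φ x = 0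
    rw [image_eq_zero_of_notMem_tsupport hx, mul_zero]

/-- **The slice balance on `[0, T]`** (CKN (2.5) with equality, unforced): at every
`t ∈ [0, T]`, `T > 0`,
`∫ (νΔφ |u|² + Dφ(u) |u|² + 2 p Dφ(u)) = ∫ φ · 2⟪u, ∂ₜu⟫ + 2ν ∫ |∇u|² φ`, with the one-sided
time derivative within `[0, T]`. -/
theorem hardyPointSink_integral_energy_flux_cutoff_Icc (hT : 0 < T)
    (h : IsClassicalNSSolutionOn (Icc 0 T) ν 0 u p) {φ : E → ℝ} (hφ : ContDiff ℝ ∞ φ)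
    (hφc : HasCompactSupport φ) {t : ℝ} (ht : t ∈ Icc 0 T) :
    ∫ x, (ν * ((Δ φ) x * ‖u t x‖ ^ 2) + fderiv ℝ φ x (u t x) * ‖u t x‖ ^ 2 +
        2 * (p t x * fderiv ℝ φ x (u t x))) =
      (∫ x, φ x * (2 * ⟪u t x, timeDerivWithin (Icc 0 T) u t x⟫)) +
        2 * ν * ∫ x, frobeniusNormSq (fderiv ℝ (u t) x) * φ x := by
  have hu2 : ContDiff ℝ 2 (u t) := (h.contDiff_velocity ht).of_le (by norm_cast)
  have hp1 : ContDiff ℝ 1 (p t) := (h.contDiff_pressure ht).of_le (by norm_cast)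
  have hdt : Continuous (timeDerivWithin (Icc 0 T) u t) :=
    ((h.smooth_velocity.timeDerivWithin (uniqueDiffOn_Icc hT)).contDiff_slice ht).continuous
  have hφ2 : ContDiff ℝ 2 φ := hφ.of_le (by norm_cast)
  have key := integral_energy_flux_eq_of_momentum (f := fun _ : E => (0 : E)) hu2 hp1 hdt
    continuous_const (fun x => by simpa using h.momentum t ht x) (h.divFree t ht) hφ2 hφc
  have e1 : ∫ x, (ν * ((Δ φ) x * ‖u t x‖ ^ 2) + fderiv ℝ φ x (u t x) * ‖u t x‖ ^ 2 +
      2 * (p t x * fderiv ℝ φ x (u t x)) + 2 * (φ x * ⟪(fun _ : E => (0 : E)) x, u t x⟫)) =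
      ∫ x, (ν * ((Δ φ) x * ‖u t x‖ ^ 2) + fderiv ℝ φ x (u t x) * ‖u t x‖ ^ 2 +
        2 * (p t x * fderiv ℝ φ x (u t x))) :=
    integral_congr_ae (Eventually.of_forall fun x => by simp)
  rw [← e1, key]

/-- **`d/dt ∫ φ |u(t)|² = ∫ φ · 2⟪u, ∂ₜu⟫` at interior times** `t ∈ (0, T)` of a classical
solution on `[0, T]`, with the one-sided time derivative within `[0, T]` on the right. -/
theorem hardyPointSink_hasDerivAt_integral_cutoff_norm_sq
    (h : IsClassicalNSSolutionOn (Icc 0 T) ν 0 u p) {φ : E → ℝ} (hφ : ContDiff ℝ ∞ φ)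
    (hφc : HasCompactSupport φ) {t : ℝ} (ht : t ∈ Ioo 0 T) :
    HasDerivAt (fun s => ∫ x, φ x * ‖u s x‖ ^ 2)
      (∫ x, φ x * (2 * ⟪u t x, timeDerivWithin (Icc 0 T) u t x⟫)) t := by
  have h' : IsClassicalNSSolutionOn (Ioo 0 T) ν 0 u p :=
    h.mono Ioo_subset_Icc_self isOpen_Ioo.uniqueDiffOn
  have hD := h'.hasDerivAt_integral_cutoff_norm_sq isOpen_Ioo hφ hφc ht
  have e : ∫ x, φ x * (2 * ⟪u t x, timeDerivWithin (Ioo 0 T) u t x⟫) =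
      ∫ x, φ x * (2 * ⟪u t x, timeDerivWithin (Icc 0 T) u t x⟫) := by
    refine integral_congr_ae (Eventually.of_forall fun x => ?_)
    simp only
    rw [h.smooth_velocity.timeDerivWithin_eq_of_subset Ioo_subset_Icc_self
      isOpen_Ioo.uniqueDiffOn ht x]
  rw [e] at hD
  exact hD

/-- **The local energy identity of a classical solution on `[0, T]`, integrated in time**
(CKN (2.5) with equality; time-independent cut-off): for a classical solution `(u, p)` of the
unforced Navier–Stokes system on the closed interval `[0, T]`, `T > 0`, `φ ∈ C_c^∞(E)` and
`0 ≤ t₀ ≤ t₁ ≤ T`,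
`∫ φ|u(t₁)|² − ∫ φ|u(t₀)|² + 2ν ∫_{t₀}^{t₁} ∫ |∇u|² φ = ∫_{t₀}^{t₁} ∫ (νΔφ |u|² + Dφ(u)|u|² + 2 p Dφ(u))`.
-/
theorem hardyPointSink_local_energy_identity_Icc (hT : 0 < T)
    (h : IsClassicalNSSolutionOn (Icc 0 T) ν 0 u p) {φ : E → ℝ} (hφ : ContDiff ℝ ∞ φ)
    (hφc : HasCompactSupport φ) {t₀ t₁ : ℝ} (ht₀ : 0 ≤ t₀) (ht₀₁ : t₀ ≤ t₁) (ht₁ : t₁ ≤ T) :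
    (∫ x, φ x * ‖u t₁ x‖ ^ 2) - (∫ x, φ x * ‖u t₀ x‖ ^ 2) +
        2 * ν * ∫ s in t₀..t₁, ∫ x, frobeniusNormSq (fderiv ℝ (u s) x) * φ x =
      ∫ s in t₀..t₁, ∫ x, (ν * ((Δ φ) x * ‖u s x‖ ^ 2) +
        fderiv ℝ φ x (u s x) * ‖u s x‖ ^ 2 + 2 * (p s x * fderiv ℝ φ x (u s x))) := by
  have hφcont : Continuous φ := hφ.continuous
  have hI : Icc t₀ t₁ ⊆ Icc 0 T := Icc_subset_Icc ht₀ ht₁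
  have hI' : uIcc t₀ t₁ ⊆ Icc 0 T := by rwa [uIcc_of_le ht₀₁]
  -- the three continuous functions of time
  have cT := hardyPointSink_continuousOn_integral_cutoff_inner_timeDeriv hT h hφcont hφc
  have cF := h.continuousOn_integral_flux_cutoff hφ hφc
  have cG := hardyPointSink_continuousOn_integral_dissipation_cutoff hT h hφcont hφc
  have cE := hardyPointSink_continuousOn_integral_cutoff_norm_sq h hφcont hφc
  have iT : IntervalIntegrable (fun s => ∫ x, φ x * (2 * ⟪u s x, timeDerivWithin (Icc 0 T) u s x⟫))
      volume t₀ t₁ := (cT.mono hI').intervalIntegrable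
  have iF : IntervalIntegrable (fun s => ∫ x, (ν * ((Δ φ) x * ‖u s x‖ ^ 2) +
      fderiv ℝ φ x (u s x) * ‖u s x‖ ^ 2 + 2 * (p s x * fderiv ℝ φ x (u s x)))) volume t₀ t₁ :=
    (cF.mono hI').intervalIntegrable
  have iG : IntervalIntegrable (fun s => ∫ x, frobeniusNormSq (fderiv ℝ (u s) x) * φ x)
      volume t₀ t₁ := (cG.mono hI').intervalIntegrable
  -- fundamental theorem of calculus on `[t₀, t₁]`, derivative at interior times
  have hFTC := intervalIntegral.integral_eq_sub_of_hasDerivAt_of_le ht₀₁ (cE.mono hI)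
    (fun s hs => hardyPointSink_hasDerivAt_integral_cutoff_norm_sq h hφ hφc
      ⟨lt_of_le_of_lt ht₀ hs.1, lt_of_lt_of_le hs.2 ht₁⟩) iT
  -- the slice balance inside the time integral
  have hslice : ∫ s in t₀..t₁, ∫ x, φ x * (2 * ⟪u s x, timeDerivWithin (Icc 0 T) u s x⟫) =
      (∫ s in t₀..t₁, ∫ x, (ν * ((Δ φ) x * ‖u s x‖ ^ 2) +
        fderiv ℝ φ x (u s x) * ‖u s x‖ ^ 2 + 2 * (p s x * fderiv ℝ φ x (u s x)))) -
      2 * ν * ∫ s in t₀..t₁, ∫ x, frobeniusNormSq (fderiv ℝ (u s) x) * φ x := by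
    rw [← intervalIntegral.integral_const_mul, ← intervalIntegral.integral_sub iF (iG.const_mul _)]
    refine intervalIntegral.integral_congr fun s hs => ?_
    have := hardyPointSink_integral_energy_flux_cutoff_Icc hT h hφ hφc (hI' hs)
    linarith
  rw [hslice] at hFTC
  linarith

end Summit.NavierStokesRegularity.NavierStokesRegularity.Theorems

end
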